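import Mathlib.Tactic.Linarith
import Mathlib.Tactic.Ring
import Summits.CriticalPhenomena.PercolationContinuityZ3.Theorems.PercNearOneGluingNoHeavyLowerTailSahiCombFiveUpSet

/-!
# The EQUALITY CASE of the Harris–Kleitman inequality: two monotone families are uncorrelated only if no coordinate is essential for both

Support file of the one-cut programme (crux `NoHeavyLowerTail`, stmt-CriticalPhenomena-4575; TRI lane of cell `prim-masterthm`; seat prim-lf-1 gen 40,
memo `FROM-prim-lf-1-gen40-CYLINDER-AND-JSWITCH.md` §3).  Mathlib's `IsLowerSet.le_card_inter_finset` / `IsUpperSet.le_card_inter_finset`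
(Harris–Kleitman: `#𝒜 · #ℬ ≤ 2^n · #(𝒜 ∩ ℬ)` for two lower sets, or two upper sets) is an equality exactly when `𝒜` and `ℬ` depend on DISJOINT
sets of coordinates.  We prove the useful direction in the pointwise form

* `FiveUpSet.Inessential a 𝒜` — coordinate `a` is inessential for the family `𝒜`: `insert a s ∈ 𝒜 ↔ s ∈ 𝒜` for every `s ∌ a`;
* **`FiveUpSet.inessential_or_of_card_mul_eq_lower'`** (ground finset version, by Mathlib's section induction: the rearrangement step
  `x₁y₀ + x₀y₁ ≤ x₁y₁ + x₀y₀` is tight only if the two `a`-sections of `𝒜` or of `ℬ` coincide, and the induction hypotheses are tight),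
  `…_lower` (whole cube, lower sets), **`…_upper`** (upper sets, via family complements as in Mathlib);
* **`FiveUpSet.inessential_or_of_kleitman_eq`** — the form used by the TRI lane: for up-sets `A, B` of the cube `Finset γ` with Kleitman's gap
  ZERO, `#(A ∩ refl B) = #(A ∩ B)` (`refl` = antipodal image), every coordinate is inessential for `A` or for `B`.  (The gap `#(A∩B) − #(A∩refl B)`
  sits between the two Harris inequalities `2^n·#(A ∩ refl B) ≤ #A·#B ≤ 2^n·#(A∩B)`, so a zero gap forces Harris equality.)
This is the first STRICT-inequality tool of the lane: on pairs of up-sets sharing an essential coordinate Kleitman's gap is `≥ 1`, which is what the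
binding rows of the non-saturated sandwich certificates need (memo §2–3: the 'perfect minus a generator' stratum and the J-switch certificates).
HONEST LABEL: complete proofs, std axioms; a classical equality characterisation (folklore for product measures), here for counting measure on the
cube and in the pointwise 'inessential coordinate' form. [this work]
-/

namespace Summit.CriticalPhenomena.PercolationContinuityZ3.Theorems

namespace FiveUpSet

open Finset

variable {α : Type*} [DecidableEq α]

/-! ### Inessential coordinates -/

/-- Coordinate `a` is INESSENTIAL for the family `𝒜`: adding `a` never changes membership. [this work] -/
def Inessential (a : α) (𝒜 : Finset (Finset α)) : Prop := ∀ s : Finset α, a ∉ s → (insert a s ∈ 𝒜 ↔ s ∈ 𝒜)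

omit [DecidableEq α] in
/-- `Inessential` in terms of Mathlib's sections: the member and non-member subfamilies at `a` coincide. [this work] -/
theorem inessential_iff_sections [DecidableEq α] {a : α} {𝒜 : Finset (Finset α)} :
    Inessential a 𝒜 ↔ 𝒜.memberSubfamily a = 𝒜.nonMemberSubfamily a := by
  constructor
  · intro h
    ext s
    rw [mem_memberSubfamily, mem_nonMemberSubfamily]
    constructor
    · rintro ⟨h1, h2⟩; exact ⟨(h s h2).1 h1, h2⟩
    · rintro ⟨h1, h2⟩; exact ⟨(h s h2).2 h1, h2⟩
  · intro h s hs
    have := Finset.ext_iff.1 h s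
    rw [mem_memberSubfamily, mem_nonMemberSubfamily] at this
    constructor
    · intro h1; exact (this.1 ⟨h1, hs⟩).1
    · intro h1; exact (this.2 ⟨h1, hs⟩).1

/-- Sections at a different coordinate commute with `memberSubfamily`: gluing the two `a`-sections. If coordinate `a' ≠ a` is inessential for both
`a`-sections of `𝒜`, it is inessential for `𝒜`. [this work] -/
theorem inessential_of_sections {a a' : α} (hne : a ≠ a') {𝒜 : Finset (Finset α)}
    (h0 : Inessential a' (𝒜.nonMemberSubfamily a)) (h1 : Inessential a' (𝒜.memberSubfamily a)) : Inessential a' 𝒜 := by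
  intro s hs
  by_cases ha : a ∈ s
  · -- write `s = insert a s'`
    have hs' : a' ∉ s.erase a := fun h => hs (mem_of_mem_erase h)
    have key := h1 (s.erase a) hs'
    rw [mem_memberSubfamily, mem_memberSubfamily] at key
    have e1 : insert a (insert a' (s.erase a)) = insert a' s := by
      rw [Finset.insert_comm, insert_erase ha]
    have e2 : insert a (s.erase a) = s := insert_erase ha
    rw [e1, e2] at key
    have hna : a ∉ insert a' (s.erase a) := by
      rw [mem_insert, not_or]; exact ⟨hne, notMem_erase a s⟩
    constructor
    · intro h; exact (key.1 ⟨h, hna⟩).1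
    · intro h; exact (key.2 ⟨h, notMem_erase a s⟩).1
  · have key := h0 s hs
    rw [mem_nonMemberSubfamily, mem_nonMemberSubfamily] at key
    have hna : a ∉ insert a' s := by
      rw [mem_insert, not_or]; exact ⟨hne, ha⟩
    constructor
    · intro h; exact (key.1 ⟨h, hna⟩).1
    · intro h; exact (key.2 ⟨h, ha⟩).1

/-! ### The equality case, lower sets, ground finset version -/

/-- Arithmetic core of the induction step: if `x₁ ≤ x₀`, `y₁ ≤ y₀`, `x₀y₀ ≤ M·P₀`, `x₁y₁ ≤ M·P₁` and `(x₁+x₀)(y₁+y₀) = 2M(P₁+P₀)`, then both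
section inequalities are tight and `x₀ = x₁ ∨ y₀ = y₁`. [this work] -/
theorem tight_of_step {x₀ x₁ y₀ y₁ M P₀ P₁ : ℕ} (hx : x₁ ≤ x₀) (hy : y₁ ≤ y₀) (h0 : x₀ * y₀ ≤ M * P₀) (h1 : x₁ * y₁ ≤ M * P₁)
    (heq : (x₁ + x₀) * (y₁ + y₀) = 2 * M * (P₁ + P₀)) :
    x₀ * y₀ = M * P₀ ∧ x₁ * y₁ = M * P₁ ∧ (x₀ = x₁ ∨ y₀ = y₁) := by
  obtain ⟨d, rfl⟩ := Nat.exists_eq_add_of_le hx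
  obtain ⟨e, rfl⟩ := Nat.exists_eq_add_of_le hy
  have hde : d * e = 0 := by nlinarith
  refine ⟨by nlinarith, by nlinarith, ?_⟩
  rcases Nat.mul_eq_zero.1 hde with h | h
  · left; omega
  · right; omega

/-- **Equality in Harris–Kleitman, lower sets, ground finset `s`.**  If two lower sets of subsets of `s` satisfy `#𝒜 · #ℬ = 2^#s · #(𝒜 ∩ ℬ)`, then
every coordinate `a ∈ s` is inessential for `𝒜` or for `ℬ`. [this work] -/
theorem inessential_or_of_card_mul_eq_lower' {𝒜 ℬ : Finset (Finset α)} {s : Finset α}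
    (h𝒜 : IsLowerSet (𝒜 : Set (Finset α))) (hℬ : IsLowerSet (ℬ : Set (Finset α)))
    (h𝒜s : ∀ t ∈ 𝒜, t ⊆ s) (hℬs : ∀ t ∈ ℬ, t ⊆ s) (heq : 𝒜.card * ℬ.card = 2 ^ s.card * (𝒜 ∩ ℬ).card) :
    ∀ a ∈ s, Inessential a 𝒜 ∨ Inessential a ℬ := by
  induction s using Finset.induction generalizing 𝒜 ℬ with
  | empty => intro a ha; exact absurd ha (notMem_empty a)
  | insert a s hs ih =>
    -- sections along `a`
    have h₀ : ∀ 𝒞 : Finset (Finset α), (∀ t ∈ 𝒞, t ⊆ insert a s) → ∀ t ∈ 𝒞.nonMemberSubfamily a, t ⊆ s := by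
      rintro 𝒞 h𝒞 t ht
      rw [mem_nonMemberSubfamily] at ht
      exact (subset_insert_iff_of_notMem ht.2).1 (h𝒞 _ ht.1)
    have h₁ : ∀ 𝒞 : Finset (Finset α), (∀ t ∈ 𝒞, t ⊆ insert a s) → ∀ t ∈ 𝒞.memberSubfamily a, t ⊆ s := by
      rintro 𝒞 h𝒞 t ht
      rw [mem_memberSubfamily] at ht
      exact (subset_insert_iff_of_notMem ht.2).1 ((subset_insert _ _).trans <| h𝒞 _ ht.1)
    have i0 := (h𝒜.nonMemberSubfamily (a := a)).le_card_inter_finset' (hℬ.nonMemberSubfamily (a := a)) (h₀ _ h𝒜s) (h₀ _ hℬs)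
    have i1 := (h𝒜.memberSubfamily (a := a)).le_card_inter_finset' (hℬ.memberSubfamily (a := a)) (h₁ _ h𝒜s) (h₁ _ hℬs)
    have hxA := card_le_card (h𝒜.memberSubfamily_subset_nonMemberSubfamily (a := a))
    have hxB := card_le_card (hℬ.memberSubfamily_subset_nonMemberSubfamily (a := a))
    rw [card_insert_of_notMem hs, ← card_memberSubfamily_add_card_nonMemberSubfamily a 𝒜,
      ← card_memberSubfamily_add_card_nonMemberSubfamily a ℬ,
      ← card_memberSubfamily_add_card_nonMemberSubfamily a (𝒜 ∩ ℬ), memberSubfamily_inter, nonMemberSubfamily_inter,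
      pow_succ] at heq
    rw [← nonMemberSubfamily_inter] at i0
    rw [← memberSubfamily_inter] at i1
    have heq' : ((𝒜.memberSubfamily a).card + (𝒜.nonMemberSubfamily a).card) * ((ℬ.memberSubfamily a).card + (ℬ.nonMemberSubfamily a).card)
        = 2 * 2 ^ s.card * ((𝒜.memberSubfamily a ∩ ℬ.memberSubfamily a).card + (𝒜.nonMemberSubfamily a ∩ ℬ.nonMemberSubfamily a).card) := by
      rw [heq]; ring
    rw [memberSubfamily_inter] at i1
    rw [nonMemberSubfamily_inter] at i0
    obtain ⟨t0, t1, hor⟩ := tight_of_step hxA hxB i0 i1 heq'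
    -- the induction hypotheses for the two section pairs
    have ih0 := ih (h𝒜.nonMemberSubfamily (a := a)) (hℬ.nonMemberSubfamily (a := a)) (h₀ _ h𝒜s) (h₀ _ hℬs)
      (by rw [← nonMemberSubfamily_inter]; rw [← nonMemberSubfamily_inter] at t0; exact t0)
    have ih1 := ih (h𝒜.memberSubfamily (a := a)) (hℬ.memberSubfamily (a := a)) (h₁ _ h𝒜s) (h₁ _ hℬs)
      (by rw [← memberSubfamily_inter]; rw [← memberSubfamily_inter] at t1; exact t1)
    intro a' ha'
    rw [mem_insert] at ha'
    rcases hor with hA | hB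
    · -- the two sections of `𝒜` coincide
      have hAeq : 𝒜.memberSubfamily a = 𝒜.nonMemberSubfamily a :=
        eq_of_subset_of_card_le (h𝒜.memberSubfamily_subset_nonMemberSubfamily) hA.le
      rcases ha' with rfl | ha'
      · exact Or.inl (inessential_iff_sections.2 hAeq)
      · have hne : a ≠ a' := fun h => hs (h ▸ ha')
        rcases ih0 a' ha' with hA0 | hB0
        · left
          refine inessential_of_sections hne hA0 ?_
          rw [hAeq]; exact hA0
        · rcases ih1 a' ha' with hA1 | hB1
          · left
            refine inessential_of_sections hne ?_ hA1
            rw [← hAeq]; exact hA1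
          · exact Or.inr (inessential_of_sections hne hB0 hB1)
    · have hBeq : ℬ.memberSubfamily a = ℬ.nonMemberSubfamily a :=
        eq_of_subset_of_card_le (hℬ.memberSubfamily_subset_nonMemberSubfamily) hB.le
      rcases ha' with rfl | ha'
      · exact Or.inr (inessential_iff_sections.2 hBeq)
      · have hne : a ≠ a' := fun h => hs (h ▸ ha')
        rcases ih0 a' ha' with hA0 | hB0
        · rcases ih1 a' ha' with hA1 | hB1
          · exact Or.inl (inessential_of_sections hne hA0 hA1)
          · right
            refine inessential_of_sections hne ?_ hB1
            rw [← hBeq]; exact hB1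
        · right
          refine inessential_of_sections hne hB0 ?_
          rw [hBeq]; exact hB0

variable [Fintype α]

/-- **Equality in Harris–Kleitman, lower sets.** [this work] -/
theorem inessential_or_of_card_mul_eq_lower {𝒜 ℬ : Finset (Finset α)}
    (h𝒜 : IsLowerSet (𝒜 : Set (Finset α))) (hℬ : IsLowerSet (ℬ : Set (Finset α)))
    (heq : 𝒜.card * ℬ.card = 2 ^ Fintype.card α * (𝒜 ∩ ℬ).card) (a : α) :
    Inessential a 𝒜 ∨ Inessential a ℬ :=
  inessential_or_of_card_mul_eq_lower' h𝒜 hℬ (fun _ _ => subset_univ _) (fun _ _ => subset_univ _)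
    (by rw [Finset.card_univ]; exact heq) a (mem_univ a)

omit [Fintype α] in
/-- A coordinate is inessential for a family iff it is inessential for the complementary family. [this work] -/
theorem inessential_compl_iff [Fintype α] {a : α} {𝒜 : Finset (Finset α)} : Inessential a 𝒜ᶜ ↔ Inessential a 𝒜 := by
  constructor
  · intro h s hs
    have := h s hs
    rw [mem_compl, mem_compl, not_iff_not] at this
    exact this
  · intro h s hs
    rw [mem_compl, mem_compl, not_iff_not]
    exact h s hs

/-- Equality in the lower/upper anticorrelation form: `2^n · #(𝒜 ∩ ℬ) = #𝒜 · #ℬ` for a lower set `𝒜` and an upper set `ℬ` forces every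
coordinate to be inessential for one of them. [this work] -/
theorem inessential_or_of_card_mul_eq_lower_upper {𝒜 ℬ : Finset (Finset α)}
    (h𝒜 : IsLowerSet (𝒜 : Set (Finset α))) (hℬ : IsUpperSet (ℬ : Set (Finset α)))
    (heq : 2 ^ Fintype.card α * (𝒜 ∩ ℬ).card = 𝒜.card * ℬ.card) (a : α) :
    Inessential a 𝒜 ∨ Inessential a ℬ := by
  -- pass to the lower set `ℬᶜ`
  rw [← isLowerSet_compl, ← coe_compl] at hℬ
  have hsplit : (𝒜 ∩ ℬ).card + (𝒜 ∩ ℬᶜ).card = 𝒜.card := by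
    rw [← card_union_of_disjoint (disjoint_compl_right.mono inter_subset_right inter_subset_right), ← inter_union_distrib_left,
      union_compl, inter_univ]
  have hB : ℬ.card + ℬᶜ.card = 2 ^ Fintype.card α := by
    have hle : ℬ.card ≤ 2 ^ Fintype.card α := by rw [← Fintype.card_finset]; exact card_le_univ _
    rw [card_compl, Fintype.card_finset]; omega
  have heq' : 𝒜.card * ℬᶜ.card = 2 ^ Fintype.card α * (𝒜 ∩ ℬᶜ).card := by
    have h1 : 𝒜.card * (ℬ.card + ℬᶜ.card) = 2 ^ Fintype.card α * ((𝒜 ∩ ℬ).card + (𝒜 ∩ ℬᶜ).card) := by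
      rw [hB, hsplit, mul_comm]
    rw [mul_add, mul_add, ← heq] at h1
    omega
  rcases inessential_or_of_card_mul_eq_lower h𝒜 hℬ heq' a with h | h
  · exact Or.inl h
  · exact Or.inr (inessential_compl_iff.1 h)

/-- **Equality in Harris–Kleitman, upper sets**: `#𝒜 · #ℬ = 2^n · #(𝒜 ∩ ℬ)` for two upper sets forces every coordinate to be inessential for `𝒜`
or for `ℬ` (the two families depend on disjoint sets of coordinates). [this work] -/
theorem inessential_or_of_card_mul_eq_upper {𝒜 ℬ : Finset (Finset α)}
    (h𝒜 : IsUpperSet (𝒜 : Set (Finset α))) (hℬ : IsUpperSet (ℬ : Set (Finset α)))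
    (heq : 𝒜.card * ℬ.card = 2 ^ Fintype.card α * (𝒜 ∩ ℬ).card) (a : α) :
    Inessential a 𝒜 ∨ Inessential a ℬ := by
  -- pass to the lower set `𝒜ᶜ`
  have h𝒜' : IsLowerSet ((𝒜ᶜ : Finset (Finset α)) : Set (Finset α)) := by
    rw [coe_compl, isLowerSet_compl]; exact h𝒜
  have hsplit : (𝒜 ∩ ℬ).card + (𝒜ᶜ ∩ ℬ).card = ℬ.card := by
    rw [← card_union_of_disjoint (disjoint_compl_right.mono inter_subset_left inter_subset_left), ← union_inter_distrib_right,
      union_compl, univ_inter]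
  have hA : 𝒜.card + 𝒜ᶜ.card = 2 ^ Fintype.card α := by
    have hle : 𝒜.card ≤ 2 ^ Fintype.card α := by rw [← Fintype.card_finset]; exact card_le_univ _
    rw [card_compl, Fintype.card_finset]; omega
  have heq' : 2 ^ Fintype.card α * (𝒜ᶜ ∩ ℬ).card = 𝒜ᶜ.card * ℬ.card := by
    have h1 : (𝒜.card + 𝒜ᶜ.card) * ℬ.card = 2 ^ Fintype.card α * ((𝒜 ∩ ℬ).card + (𝒜ᶜ ∩ ℬ).card) := by
      rw [hA, hsplit]
    rw [add_mul, mul_add, heq] at h1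
    omega
  rcases inessential_or_of_card_mul_eq_lower_upper h𝒜' hℬ heq' a with h | h
  · exact Or.inl (inessential_compl_iff.1 h)
  · exact Or.inr h

/-! ### Kleitman's gap vanishes only on pairs without a common essential coordinate -/

/-- **Zero Kleitman gap forces disjoint supports.**  For up-sets `A, B` of the cube with `#(A ∩ refl B) = #(A ∩ B)` (`refl` = antipodal image),
every coordinate is inessential for `A` or for `B`.  Equivalently: if some coordinate is essential for both, then `#(A ∩ refl B) < #(A ∩ B)`.
[this work] -/
theorem inessential_or_of_kleitman_eq {A B : Finset (Finset α)}
    (hA : IsUpperSet (A : Set (Finset α))) (hB : IsUpperSet (B : Set (Finset α)))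
    (hgap : (A ∩ refl B).card = (A ∩ B).card) (a : α) :
    Inessential a A ∨ Inessential a B := by
  have h1 : 2 ^ Fintype.card α * (A ∩ refl B).card ≤ A.card * (refl B).card := hA.card_inter_le_finset (isLowerSet_refl hB)
  have h2 : A.card * B.card ≤ 2 ^ Fintype.card α * (A ∩ B).card := hA.le_card_inter_finset hB
  rw [card_refl, hgap] at h1
  exact inessential_or_of_card_mul_eq_upper hA hB (le_antisymm h2 h1) a

/-- Contrapositive, the form used in certificate proofs: if coordinate `a` is ESSENTIAL for both up-sets (`insert a s ∈ A` but `s ∉ A` for some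
`s ∌ a`, and likewise for `B`), then Kleitman's gap is positive: `#(A ∩ refl B) < #(A ∩ B)`. [this work] -/
theorem card_inter_refl_lt_of_essential {A B : Finset (Finset α)}
    (hA : IsUpperSet (A : Set (Finset α))) (hB : IsUpperSet (B : Set (Finset α))) {a : α}
    {s : Finset α} (hs : a ∉ s) (hsA : insert a s ∈ A) (hsA' : s ∉ A)
    {t : Finset α} (ht : a ∉ t) (htB : insert a t ∈ B) (htB' : t ∉ B) :
    (A ∩ refl B).card < (A ∩ B).card := by
  refine lt_of_le_of_ne (card_inter_refl_le hA hB) fun h => ?_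
  rcases inessential_or_of_kleitman_eq hA hB h a with hI | hI
  · exact hsA' ((hI s hs).1 hsA)
  · exact htB' ((hI t ht).1 htB)

end FiveUpSet

end Summit.CriticalPhenomena.PercolationContinuityZ3.Theorems
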